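import Literature.NumberTheory.EllipticCurves.BinaryQuarticPadicOrbitMass
import Literature.NumberTheory.EllipticCurves.BinaryQuarticOrbitWeightsMassIdentityProofs
import Literature.NumberTheory.EllipticCurves.BhargavaShankarLocalOrbitMass
import HarnessLib

/-!
# The mass of a fibre: `Σ_{𝒪 ⊆ V_{ℤ_p}, (I,J)(𝒪) = (I,J), soluble} 1/(m_p(𝒪) #Aut_{ℤ_p}(𝒪)) = #(E/2E)/#E[2]`
# (Bhargava–Shankar, proof of Prop. 5.12: Cor. 3.8 + Lemmas 5.10–5.11)

Companion of `BinaryQuarticPadicOrbitMass.lean` (the `p`-adic change of measure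
`μ_p(A) = (1 − p⁻²)|1/27|_p ∫ N_A`), preparing the computation of `∫ φ_p dμ_p` (Prop. 5.12):
the value of the fibre sums. One auxiliary definition (`solubleFibreOrbits`); theorems; no
named facts.

* §1 **Dictionary** between the integral model (`GL₂(ℤ_p)` acting on `V_{ℤ_p}`, `#Aut_{ℤ_p} =
  autCard`) and the rational one (`ℚ_pˣGL₂(ℤ_p) ≤ GL₂(ℚ_p)` acting on `V_{ℚ_p}`, `autIntCard`):
  `Stab_{GL₂(ℚ_p)}(f) ∩ ℚ_pˣGL₂(ℤ_p) = ℚ_pˣ · ι(Stab_{GL₂(ℤ_p)}(f))` and `autCard f = autIntCard ι f`.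
* §2 **Re-weighting**: for an invariant `w : V_{ℤ_p} → ℕ`,
  `Σ_n n⁻¹ N_{A ∩ {w = n}}(I,J) = Σ_{𝒪 ⊆ A over (I,J)} 1/(w(𝒪) #Aut_{ℤ_p}(𝒪))`.
* §3 **The fibre identity**: for `(I,J) ∈ ℤ_p²` with `4I³ ≠ J²` such that every soluble
  `ℚ_p`-class with invariants `(I,J)` meets `V_{ℤ_p}`,
  `Σ_{𝒪 soluble over (I,J)} 1/(m_p(𝒪) #Aut_{ℤ_p}(𝒪)) = Σ_{soluble classes c} 1/#Aut_{ℚ_p}(c)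
   = #(E_{I,J}(ℚ_p)/2)/#E_{I,J}(ℚ_p)[2]` (`= localSelmerRatio p (I,J)`), by regrouping the orbits
  by `PGL₂(ℚ_p)`-class (the orbits inside a class are Bhargava–Shankar's `B_p(f)`), Cor. 3.8
  (`finsum_inv_localWeight_mul_autIntCard`) and Lemmas 5.10–5.11
  (`finsum_inv_pgl2StabilizerCard_eq_localSelmerRatio`).

## References

* M. Bhargava, A. Shankar, Ann. of Math. (2) 181 (2015) 191–242, §3.2, Cor. 3.8, proof of
  Prop. 3.9 (published numbering); proof of Prop. 5.12 (arXiv:1006.1002v2).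
  [cite: BhargavaShankarAnnals2015, Prop. 5.12 proof and Cor. 3.8 (arXiv:1006.1002v2 / published numbering)]
-/

noncomputable section

open scoped Classical Pointwise ENNReal NNReal
open Matrix MulAction Set MeasureTheory Literature.GroupTheory.Index

namespace Literature.NumberTheory.EllipticCurves

namespace BinaryQuartic

open scoped IntegralAction

variable {p : ℕ} [Fact p.Prime]

local notation "G" => GL (Fin 2) ℤ_[p]
local notation "ιp" => PadicInt.Coe.ringHom (p := p)

/-! ## §1 The dictionary `GL₂(ℤ_p) ↔ ℚ_pˣ GL₂(ℤ_p)` -/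

/-- The localisation `GL₂(ℤ_p) → GL₂(ℚ_p)` is injective. [folklore] -/
theorem mapGL_injective : Function.Injective (Matrix.GeneralLinearGroup.map (n := Fin 2) ιp) := by
  intro k k' h
  apply Units.ext
  have h' := congrArg (fun g : GL (Fin 2) ℚ_[p] ↦ (g : Matrix (Fin 2) (Fin 2) ℚ_[p])) h
  exact map_coe_injective_matrix h'

/-- The localisation intertwines the actions: `ι(k) • ι(f) = ι(k • f)`. [folklore] -/
theorem mapGL_smul_map (k : G) (f : BinaryQuartic ℤ_[p]) :
    Matrix.GeneralLinearGroup.map ιp k • f.map ιp = (k • f).map ιp :=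
  (map_glInt_smul' k f).symm

/-- `ι(k)` lies in `ℚ_pˣ GL₂(ℤ_p)`. [folklore] -/
theorem mapGL_mem_integralUpToScalars (k : G) :
    Matrix.GeneralLinearGroup.map ιp k ∈ integralUpToScalars ιp :=
  mem_integralUpToScalars_of_eq_map _ (Matrix.isUnits_det_units k) rfl

/-- `V_{ℤ_p} → V_{ℚ_p}` is injective. [folklore] -/
theorem map_coe_injective_form :
    Function.Injective (BinaryQuartic.map ιp : BinaryQuartic ℤ_[p] → BinaryQuartic ℚ_[p]) := by
  intro f g h
  apply coeffs_injective
  funext i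
  have := congrFun (congrArg coeffs h) i
  simp only [coeffs_map] at this
  exact Subtype.coe_injective this

/-- An element of `GL₂(ℤ_p)` whose image in `GL₂(ℚ_p)` is a scalar is a unit scalar. [folklore] -/
theorem mem_scalarSubgroup_of_map_eq_smul_one {k : G} {c : ℚ_[p]}
    (hc : (k : Matrix (Fin 2) (Fin 2) ℤ_[p]).map ιp = c • (1 : Matrix (Fin 2) (Fin 2) ℚ_[p])) :
    k ∈ GL2.scalarSubgroup := by
  have h00 := congrFun (congrFun hc 0) 0
  have h01 := congrFun (congrFun hc 0) 1
  have h10 := congrFun (congrFun hc 1) 0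
  have h11 := congrFun (congrFun hc 1) 1
  simp [Matrix.map_apply] at h00 h01 h10 h11
  have hunit : IsUnit ((k : Matrix (Fin 2) (Fin 2) ℤ_[p]) 0 0 * (k : Matrix (Fin 2) (Fin 2) ℤ_[p]) 1 1) := by
    have hdet : IsUnit (k : Matrix (Fin 2) (Fin 2) ℤ_[p]).det := by
      rw [← Matrix.GeneralLinearGroup.val_det_apply]; exact Units.isUnit _
    rw [Matrix.det_fin_two] at hdet
    have h01' : (k : Matrix (Fin 2) (Fin 2) ℤ_[p]) 0 1 = 0 := by exact_mod_cast h01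
    rwa [h01', zero_mul, sub_zero] at hdet
  obtain ⟨c₀, hc₀⟩ := isUnit_of_mul_isUnit_left hunit
  rw [GL2.mem_scalarSubgroup_iff]
  refine ⟨c₀, ?_⟩
  apply map_coe_injective_matrix
  rw [hc]
  have hcc : c = ((c₀ : ℤ_[p]) : ℚ_[p]) := by rw [hc₀]; exact h00.symm
  rw [hcc]
  ext i j
  fin_cases i <;> fin_cases j <;> simp [Matrix.map_apply]

/-- **Elements of `GL₂(ℤ_p)` that become central in `GL₂(ℚ_p)` are the unit scalars**:
`ι⁻¹(Z(GL₂(ℚ_p))) = ℤ_pˣ`. [folklore] -/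
theorem comap_center_mapGL :
    (Subgroup.center (GL (Fin 2) ℚ_[p])).comap (Matrix.GeneralLinearGroup.map (n := Fin 2) ιp) = GL2.scalarSubgroup := by
  ext k
  rw [Subgroup.mem_comap, mem_center_iff_exists_smul_one]
  constructor
  · rintro ⟨c, -, hk⟩
    exact mem_scalarSubgroup_of_map_eq_smul_one (by rw [← coe_mapGL]; exact hk)
  · intro hk
    obtain ⟨u, hu⟩ := (GL2.mem_scalarSubgroup_iff k).mp hk
    refine ⟨((u : ℤ_[p]) : ℚ_[p]), PadicInt.coe_ne_zero.mpr u.ne_zero, ?_⟩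
    rw [coe_mapGL, hu]
    ext i j
    fin_cases i <;> fin_cases j <;> simp [Matrix.map_apply]

/-- **`Stab_{GL₂(ℚ_p)}(f) ∩ ℚ_pˣGL₂(ℤ_p) = Z · ι(Stab_{GL₂(ℤ_p)}(f))`** for `f ∈ V_{ℤ_p}`. [folklore] -/
theorem stabilizer_inf_integralUpToScalars_eq (f : BinaryQuartic ℤ_[p]) :
    stabilizer (GL (Fin 2) ℚ_[p]) (f.map ιp) ⊓ integralUpToScalars ιp =
      Subgroup.center (GL (Fin 2) ℚ_[p]) ⊔ (stabilizer G f).map (Matrix.GeneralLinearGroup.map (n := Fin 2) ιp) := by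
  apply le_antisymm
  · intro γ hγ
    obtain ⟨hγs, hγi⟩ := Subgroup.mem_inf.mp hγ
    obtain ⟨c, k, hc, hck⟩ := exists_eq_scalar_mul_map hγi
    -- `γ = z · ι(k)` with `z = c · 1` central
    set z : GL (Fin 2) ℚ_[p] := γ * (Matrix.GeneralLinearGroup.map ιp k)⁻¹ with hz
    have hzmat : (z : Matrix (Fin 2) (Fin 2) ℚ_[p]) = c • (1 : Matrix (Fin 2) (Fin 2) ℚ_[p]) := by
      rw [hz, Units.val_mul, hck, Matrix.smul_mul, ← Units.val_mul, mul_inv_cancel, Units.val_one]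
    have hzc : z ∈ Subgroup.center (GL (Fin 2) ℚ_[p]) := (mem_center_iff_exists_smul_one z).mpr ⟨c, hc, hzmat⟩
    have hγz : γ = z * Matrix.GeneralLinearGroup.map ιp k := by rw [hz]; group
    -- `ι(k)` stabilises `f ⊗ ℚ_p`, hence `k` stabilises `f`
    have hks : Matrix.GeneralLinearGroup.map ιp k ∈ stabilizer (GL (Fin 2) ℚ_[p]) (f.map ιp) := by
      have : Matrix.GeneralLinearGroup.map ιp k = z⁻¹ * γ := by rw [hγz]; group
      rw [this]
      exact (stabilizer _ _).mul_mem ((stabilizer _ _).inv_mem (center_le_stabilizer _ hzc)) hγs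
    have hk : k ∈ stabilizer G f := by
      rw [mem_stabilizer_iff]
      apply map_coe_injective_form
      rw [← mapGL_smul_map]
      exact mem_stabilizer_iff.mp hks
    rw [hγz]
    exact Subgroup.mul_mem_sup hzc ⟨k, hk, rfl⟩
  · refine sup_le (le_inf (center_le_stabilizer _) (center_le_integralUpToScalars _)) ?_
    rintro _ ⟨k, hk, rfl⟩
    refine Subgroup.mem_inf.mpr ⟨?_, mapGL_mem_integralUpToScalars k⟩
    rw [mem_stabilizer_iff, mapGL_smul_map, mem_stabilizer_iff.mp hk]

/-- **`#Aut_{ℤ_p}(f) = autIntCard ι (f ⊗ ℚ_p)`**: the integral automorphism count of the tube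
files agrees with Bhargava–Shankar's `#Aut_{ℤ_p}(f)` of `BinaryQuarticOrbitWeights`
(`[Stab(f) ∩ ℚ_pˣGL₂(ℤ_p) : ℚ_pˣ] = [Stab_{GL₂(ℤ_p)}(f) : ℤ_pˣ]`). [cite: BhargavaShankarAnnals2015, §3.2 (Aut_{ℤ_p}(f); published numbering)] -/
theorem autCard_eq_autIntCard (f : BinaryQuartic ℤ_[p]) : autCard f = autIntCard ιp (f.map ιp) := by
  rw [autIntCard, stabilizer_inf_integralUpToScalars_eq, Subgroup.relIndex_sup_left, ← Subgroup.relIndex_comap,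
    comap_center_mapGL, autCard]

/-! ## §2 Re-weighting the fibre mass by an invariant function -/

/-- A function invariant under `GL₂(ℤ_p)` is constant on orbits. [folklore] -/
theorem eq_of_mem_orbit_of_invariant {w : BinaryQuartic ℤ_[p] → ℕ} (hw : ∀ g : G, ∀ f, w (g • f) = w f)
    {q : orbitRel.Quotient G (BinaryQuartic ℤ_[p])} {f : BinaryQuartic ℤ_[p]} (hf : f ∈ orbitRel.Quotient.orbit q) :
    w f = w (Quotient.out q) := by
  rw [orbitRel.Quotient.orbit_eq_orbit_out q Quotient.out_eq', mem_orbit_iff] at hf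
  obtain ⟨g, rfl⟩ := hf
  exact hw g _

/-- The orbits of `A ∩ {w = n}` over `IJ` are the orbits of `A` over `IJ` on which `w = n`. [folklore] -/
theorem fibreOrbits_inter_level (A : Set (BinaryQuartic ℤ_[p])) {w : BinaryQuartic ℤ_[p] → ℕ}
    (hw : ∀ g : G, ∀ f, w (g • f) = w f) (IJ : ℤ_[p] × ℤ_[p]) (n : ℕ) :
    fibreOrbits (A ∩ {f | w f = n}) IJ = {q | q ∈ fibreOrbits A IJ ∧ w (Quotient.out q) = n} := by
  ext q
  simp only [fibreOrbits, mem_setOf_eq, subset_inter_iff]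
  have hout : Quotient.out q ∈ orbitRel.Quotient.orbit q := by
    rw [orbitRel.Quotient.mem_orbit]; exact Quotient.out_eq' q
  constructor
  · rintro ⟨⟨hA, hw'⟩, hIJ⟩
    exact ⟨⟨hA, hIJ⟩, hw' hout⟩
  · rintro ⟨⟨hA, hIJ⟩, hn⟩
    refine ⟨⟨hA, fun f hf ↦ ?_⟩, hIJ⟩
    show w f = n
    rw [eq_of_mem_orbit_of_invariant hw hf, hn]

/-- **Re-weighting**: `Σ_n n⁻¹ · N_{A ∩ {w = n}}(IJ) = Σ_{𝒪 ⊆ A over IJ} 1/(w(𝒪) · #Aut_{ℤ_p}(𝒪))` for a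
`GL₂(ℤ_p)`-invariant `w : V_{ℤ_p} → ℕ`. [folklore] -/
theorem tsum_inv_mul_fibreMass_level (A : Set (BinaryQuartic ℤ_[p])) {w : BinaryQuartic ℤ_[p] → ℕ}
    (hw : ∀ g : G, ∀ f, w (g • f) = w f) (IJ : ℤ_[p] × ℤ_[p]) :
    ∑' n : ℕ, (n : ℝ≥0∞)⁻¹ * fibreMass (A ∩ {f | w f = n}) IJ =
      ∑' q : fibreOrbits A IJ, ((w (Quotient.out (q : orbitRel.Quotient G (BinaryQuartic ℤ_[p]))) : ℝ≥0∞))⁻¹ *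
        ((autCard (Quotient.out (q : orbitRel.Quotient G (BinaryQuartic ℤ_[p]))) : ℝ≥0∞))⁻¹ := by
  -- abbreviations
  set a : orbitRel.Quotient G (BinaryQuartic ℤ_[p]) → ℝ≥0∞ := fun q ↦ ((autCard (Quotient.out q) : ℝ≥0∞))⁻¹ with ha
  set F := fibreOrbits A IJ with hF
  have hlevel : ∀ n : ℕ, fibreMass (A ∩ {f | w f = n}) IJ =
      ∑' q : orbitRel.Quotient G (BinaryQuartic ℤ_[p]), {q | q ∈ F ∧ w (Quotient.out q) = n}.indicator a q := by
    intro n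
    rw [fibreMass, ← tsum_subtype]
    exact (fibreOrbits_inter_level A hw IJ n) ▸ rfl
  simp_rw [hlevel, ← ENNReal.tsum_mul_left]
  rw [ENNReal.tsum_comm]
  have hrhs : ∑' q : F, ((w (Quotient.out (q : orbitRel.Quotient G (BinaryQuartic ℤ_[p]))) : ℝ≥0∞))⁻¹ * a q =
      ∑' q : orbitRel.Quotient G (BinaryQuartic ℤ_[p]), F.indicator (fun q ↦ ((w (Quotient.out q) : ℝ≥0∞))⁻¹ * a q) q :=
    (tsum_subtype F fun q ↦ ((w (Quotient.out q) : ℝ≥0∞))⁻¹ * a q)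
  rw [hrhs]
  refine tsum_congr fun q ↦ ?_
  by_cases hq : q ∈ F
  · rw [indicator_of_mem hq]
    have hterm : ∀ n : ℕ, (n : ℝ≥0∞)⁻¹ * {q | q ∈ F ∧ w (Quotient.out q) = n}.indicator a q =
        if n = w (Quotient.out q) then ((w (Quotient.out q) : ℝ≥0∞))⁻¹ * a q else 0 := by
      intro n
      by_cases hn : n = w (Quotient.out q)
      · rw [if_pos hn, indicator_of_mem (show q ∈ {q | q ∈ F ∧ w (Quotient.out q) = n} from ⟨hq, hn.symm⟩), hn]
      · rw [if_neg hn, indicator_of_notMem, mul_zero]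
        rintro ⟨-, h⟩; exact hn h.symm
    simp_rw [hterm]
    exact tsum_ite_eq (w (Quotient.out q)) _
  · rw [indicator_of_notMem hq]
    refine ENNReal.tsum_eq_zero.mpr fun n ↦ ?_
    rw [indicator_of_notMem, mul_zero]
    rintro ⟨h, -⟩; exact hq h

/-! ## §3 Soluble orbits over `(I, J)` and their `PGL₂(ℚ_p)`-classes -/

section Fibre

variable (IJ : ℤ_[p] × ℤ_[p])

/-- The `GL₂(ℤ_p)`-orbits in `V_{ℤ_p}` of `ℚ_p`-soluble forms with invariants `(I, J)`. [folklore] -/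
def solubleFibreOrbits : Set (orbitRel.Quotient G (BinaryQuartic ℤ_[p])) :=
  fibreOrbits {f | (f.map ιp).IsSoluble} IJ

variable {IJ}

/-- The representative of a soluble orbit over `(I,J)` is soluble with invariants `(I,J)`. [folklore] -/
theorem out_spec {q : orbitRel.Quotient G (BinaryQuartic ℤ_[p])} (hq : q ∈ solubleFibreOrbits IJ) :
    ((Quotient.out q).map ιp).IsSoluble ∧ invPair (Quotient.out q) = IJ := by
  have hout : Quotient.out q ∈ orbitRel.Quotient.orbit q := by
    rw [orbitRel.Quotient.mem_orbit]; exact Quotient.out_eq' q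
  exact ⟨hq.1 hout, hq.2 _ hout⟩

/-- The representative of a soluble orbit over `(I,J)`, in `V_{ℚ_p}`, as a soluble form with
invariants `(I, J)`. [folklore] -/
def toSol (q : solubleFibreOrbits IJ) : solubleForms (IJ.1 : ℚ_[p]) (IJ.2 : ℚ_[p]) :=
  ⟨(Quotient.out (q : orbitRel.Quotient G (BinaryQuartic ℤ_[p]))).map ιp, by
    obtain ⟨hsol, hIJ⟩ := out_spec q.2
    simp only [invPair, Prod.ext_iff] at hIJ
    exact ⟨by rw [I_map, hIJ.1]; rfl, by rw [J_map, hIJ.2]; rfl, hsol⟩⟩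

/-- The `PGL₂(ℚ_p)`-class of a soluble orbit. [folklore] -/
def cl (q : solubleFibreOrbits IJ) : Quotient (pgl2Setoid (IJ.1 : ℚ_[p]) (IJ.2 : ℚ_[p])) :=
  Quotient.mk _ (toSol q)

/-- `toSol q` as a form. [folklore] -/
theorem coe_toSol (q : solubleFibreOrbits IJ) :
    ((toSol q : solubleForms (IJ.1 : ℚ_[p]) (IJ.2 : ℚ_[p])) : BinaryQuartic ℚ_[p]) =
      (Quotient.out (q : orbitRel.Quotient G (BinaryQuartic ℤ_[p]))).map ιp := rfl

/-- The orbit of a quotient point is the orbit of its representative. [folklore] -/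
theorem orbit_eq_orbit_out' (q : orbitRel.Quotient G (BinaryQuartic ℤ_[p])) :
    orbitRel.Quotient.orbit q = orbit G (Quotient.out q) :=
  orbitRel.Quotient.orbit_eq_orbit_out q Quotient.out_eq'

/-- The image in `V_{ℚ_p}` of a `GL₂(ℤ_p)`-orbit is the `ℚ_pˣGL₂(ℤ_p)`-orbit of the image of its
representative. [folklore] -/
theorem image_orbit_eq (q : orbitRel.Quotient G (BinaryQuartic ℤ_[p])) :
    BinaryQuartic.map ιp '' orbitRel.Quotient.orbit q = orbit (integralUpToScalars ιp) ((Quotient.out q).map ιp) := by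
  rw [orbit_eq_orbit_out', image_orbit_eq_orbit_integralUpToScalars]

/-- Two classes in the soluble quotient agree iff representatives are `PGL₂`-equivalent. [folklore] -/
theorem cl_eq_iff (q : solubleFibreOrbits IJ) (c : Quotient (pgl2Setoid (IJ.1 : ℚ_[p]) (IJ.2 : ℚ_[p]))) :
    cl q = c ↔ PGL2Equiv ((Quotient.out (q : orbitRel.Quotient G (BinaryQuartic ℤ_[p]))).map ιp) (c.out : solubleForms (IJ.1 : ℚ_[p]) (IJ.2 : ℚ_[p])).1 := by
  rw [cl, Quotient.mk_eq_iff_out]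
  rfl

/-- An integral representative of a soluble class (granted that every soluble class meets
`V_{ℤ_p}`). [folklore] -/
def rep (hint : ∀ F : BinaryQuartic ℚ_[p], F.I = (IJ.1 : ℚ_[p]) → F.J = (IJ.2 : ℚ_[p]) → F.IsSoluble →
      ∃ g : BinaryQuartic ℤ_[p], PGL2Equiv F (g.map ιp))
    (c : Quotient (pgl2Setoid (IJ.1 : ℚ_[p]) (IJ.2 : ℚ_[p]))) : BinaryQuartic ℤ_[p] :=
  (hint (c.out : solubleForms (IJ.1 : ℚ_[p]) (IJ.2 : ℚ_[p])).1 (c.out : solubleForms (IJ.1 : ℚ_[p]) (IJ.2 : ℚ_[p])).2.1 (c.out : solubleForms (IJ.1 : ℚ_[p]) (IJ.2 : ℚ_[p])).2.2.1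
    (c.out : solubleForms (IJ.1 : ℚ_[p]) (IJ.2 : ℚ_[p])).2.2.2).choose

/-- The integral representative lies in the class. [folklore] -/
theorem rep_spec (hint : ∀ F : BinaryQuartic ℚ_[p], F.I = (IJ.1 : ℚ_[p]) → F.J = (IJ.2 : ℚ_[p]) → F.IsSoluble →
      ∃ g : BinaryQuartic ℤ_[p], PGL2Equiv F (g.map ιp))
    (c : Quotient (pgl2Setoid (IJ.1 : ℚ_[p]) (IJ.2 : ℚ_[p]))) :
    PGL2Equiv (c.out : solubleForms (IJ.1 : ℚ_[p]) (IJ.2 : ℚ_[p])).1 ((rep hint c).map ιp) :=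
  (hint (c.out : solubleForms (IJ.1 : ℚ_[p]) (IJ.2 : ℚ_[p])).1 (c.out : solubleForms (IJ.1 : ℚ_[p]) (IJ.2 : ℚ_[p])).2.1 (c.out : solubleForms (IJ.1 : ℚ_[p]) (IJ.2 : ℚ_[p])).2.2.1
    (c.out : solubleForms (IJ.1 : ℚ_[p]) (IJ.2 : ℚ_[p])).2.2.2).choose_spec

/-- **The image of a soluble orbit of class `c` is one of Bhargava–Shankar's orbits `B_p` of the
integral representative of `c`.** [folklore] -/
theorem image_orbit_mem_intClassOrbits (hint : ∀ F : BinaryQuartic ℚ_[p], F.I = (IJ.1 : ℚ_[p]) → F.J = (IJ.2 : ℚ_[p]) → F.IsSoluble →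
      ∃ g : BinaryQuartic ℤ_[p], PGL2Equiv F (g.map ιp))
    (q : solubleFibreOrbits IJ) :
    BinaryQuartic.map ιp '' orbitRel.Quotient.orbit (q : orbitRel.Quotient G (BinaryQuartic ℤ_[p])) ∈
      intClassOrbits ιp ((rep hint (cl q)).map ιp) := by
  rw [mem_intClassOrbits_iff]
  refine ⟨(Quotient.out (q : orbitRel.Quotient G (BinaryQuartic ℤ_[p]))).map ιp, ⟨?_, map_mem_integralForms _ _⟩,
    (image_orbit_eq _).symm⟩
  rw [mem_orbit_iff_pgl2Equiv]
  exact ((cl_eq_iff q (cl q)).mp rfl |>.trans (rep_spec hint (cl q))).symm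

/-- Orbits with the same image in `V_{ℚ_p}` are equal. [folklore] -/
theorem eq_of_image_orbit_eq {q q' : orbitRel.Quotient G (BinaryQuartic ℤ_[p])}
    (h : BinaryQuartic.map ιp '' orbitRel.Quotient.orbit q = BinaryQuartic.map ιp '' orbitRel.Quotient.orbit q') : q = q' := by
  have horb : orbitRel.Quotient.orbit q = orbitRel.Quotient.orbit q' :=
    (Set.image_injective.mpr map_coe_injective_form) h
  have hout : Quotient.out q ∈ orbitRel.Quotient.orbit q' := by
    rw [← horb, orbitRel.Quotient.mem_orbit]; exact Quotient.out_eq' q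
  rw [orbitRel.Quotient.mem_orbit] at hout
  rw [← hout]
  exact (Quotient.out_eq' q).symm

/-- **Every orbit `O ∈ B_p(rep c)` is the image of a soluble orbit over `(I,J)` of class `c`.**
[folklore] -/
theorem exists_eq_image_orbit (hint : ∀ F : BinaryQuartic ℚ_[p], F.I = (IJ.1 : ℚ_[p]) → F.J = (IJ.2 : ℚ_[p]) → F.IsSoluble →
      ∃ g : BinaryQuartic ℤ_[p], PGL2Equiv F (g.map ιp))
    {c : Quotient (pgl2Setoid (IJ.1 : ℚ_[p]) (IJ.2 : ℚ_[p]))} {O : Set (BinaryQuartic ℚ_[p])}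
    (hO : O ∈ intClassOrbits ιp ((rep hint c).map ιp)) :
    ∃ q : solubleFibreOrbits IJ, cl q = c ∧
      BinaryQuartic.map ιp '' orbitRel.Quotient.orbit (q : orbitRel.Quotient G (BinaryQuartic ℤ_[p])) = O := by
  obtain ⟨y, ⟨hyorb, f', rfl⟩, rfl⟩ := (mem_intClassOrbits_iff _ _ _).mp hO
  rw [mem_orbit_iff_pgl2Equiv] at hyorb
  -- `f'` is soluble with invariants `(I, J)`: compare with `c.out`
  have hequiv : PGL2Equiv (c.out : solubleForms (IJ.1 : ℚ_[p]) (IJ.2 : ℚ_[p])).1 (f'.map ιp) := (rep_spec hint c).trans hyorb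
  obtain ⟨hcI, hcJ, hcsol⟩ := (c.out : solubleForms (IJ.1 : ℚ_[p]) (IJ.2 : ℚ_[p])).2
  have hsol : (f'.map ιp).IsSoluble := hequiv.isSoluble_iff.mpr hcsol
  have hI : f'.I = IJ.1 := by
    have := hequiv.I_eq
    rw [hcI, I_map] at this
    exact Subtype.coe_injective this
  have hJ : f'.J = IJ.2 := by
    have := hequiv.J_eq
    rw [hcJ, J_map] at this
    exact Subtype.coe_injective this
  set q : orbitRel.Quotient G (BinaryQuartic ℤ_[p]) := Quotient.mk'' f' with hq
  have hqorb : orbitRel.Quotient.orbit q = orbit G f' := by rw [hq, orbitRel.Quotient.orbit_mk]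
  have hqmem : q ∈ solubleFibreOrbits IJ := by
    refine ⟨?_, ?_⟩
    · rintro _ hg
      rw [hqorb] at hg
      obtain ⟨g, rfl⟩ := hg
      show ((g • f').map ιp).IsSoluble
      rw [← mapGL_smul_map]
      exact (PGL2Equiv.isSoluble_iff ((mem_orbit_iff_pgl2Equiv _ _).mp ⟨_, rfl⟩)).mpr hsol
    · rintro _ hg
      rw [hqorb] at hg
      obtain ⟨g, rfl⟩ := hg
      show invPair (g • f') = IJ
      rw [invPair_glInt_smul, invPair, hI, hJ]
  refine ⟨⟨q, hqmem⟩, ?_, ?_⟩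
  · -- the class of `q` is `c`
    rw [cl_eq_iff]
    -- `out q = g • f'` for some `g`
    have hout : Quotient.out q ∈ orbit G f' := by
      rw [← hqorb, orbitRel.Quotient.mem_orbit]; exact Quotient.out_eq' q
    obtain ⟨g, hg⟩ := hout
    have h1 : PGL2Equiv (f'.map ιp) ((Quotient.out q).map ιp) := by
      rw [← mem_orbit_iff_pgl2Equiv, ← hg, ← mapGL_smul_map]; exact ⟨_, rfl⟩
    exact h1.symm.trans hequiv.symm
  · show BinaryQuartic.map ιp '' orbitRel.Quotient.orbit q = _
    rw [hqorb, image_orbit_eq_orbit_integralUpToScalars]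

end Fibre

/-! ## §4 The fibre identity -/

section FibreSum

variable {IJ : ℤ_[p] × ℤ_[p]}

/-- A form over `ℚ_p` with invariants `(I, J)`, `4I³ ≠ J²`, has `Δ ≠ 0`. [folklore] -/
theorem disc_ne_zero_of_invariants_padic (h4 : 4 * IJ.1 ^ 3 - IJ.2 ^ 2 ≠ 0) {F : BinaryQuartic ℚ_[p]}
    (hI : F.I = (IJ.1 : ℚ_[p])) (hJ : F.J = (IJ.2 : ℚ_[p])) : F.disc ≠ 0 := by
  intro h0
  have := twentySeven_mul_disc F
  rw [h0, mul_zero, hI, hJ] at this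
  exact four_mul_pow_sub_sq_cast_ne_zero p h4 this.symm

/-- The integral representative of a class has `Δ ≠ 0`. [folklore] -/
theorem disc_rep_ne_zero (h4 : 4 * IJ.1 ^ 3 - IJ.2 ^ 2 ≠ 0)
    (hint : ∀ F : BinaryQuartic ℚ_[p], F.I = (IJ.1 : ℚ_[p]) → F.J = (IJ.2 : ℚ_[p]) → F.IsSoluble →
      ∃ g : BinaryQuartic ℤ_[p], PGL2Equiv F (g.map ιp))
    (c : Quotient (pgl2Setoid (IJ.1 : ℚ_[p]) (IJ.2 : ℚ_[p]))) : (rep hint c).disc ≠ 0 := by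
  have heq := rep_spec hint c
  obtain ⟨hcI, hcJ, -⟩ := (c.out : solubleForms (IJ.1 : ℚ_[p]) (IJ.2 : ℚ_[p])).2
  have hI : ((rep hint c).map ιp).I = (IJ.1 : ℚ_[p]) := by rw [heq.I_eq, hcI]
  have hJ : ((rep hint c).map ιp).J = (IJ.2 : ℚ_[p]) := by rw [heq.J_eq, hcJ]
  have h := disc_ne_zero_of_invariants_padic h4 hI hJ
  rw [disc_map] at h
  exact fun h0 ↦ h (by rw [h0, map_zero])

/-- `#Aut_{ℚ_p}` of the integral representative is `#E_{I,J}(ℚ_p)[2] ≠ 0`. [folklore] -/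
theorem pgl2StabilizerCard_rep
    (hint : ∀ F : BinaryQuartic ℚ_[p], F.I = (IJ.1 : ℚ_[p]) → F.J = (IJ.2 : ℚ_[p]) → F.IsSoluble →
      ∃ g : BinaryQuartic ℤ_[p], PGL2Equiv F (g.map ιp))
    (c : Quotient (pgl2Setoid (IJ.1 : ℚ_[p]) (IJ.2 : ℚ_[p]))) :
    pgl2StabilizerCard ((rep hint c).map ιp) = pgl2StabilizerCard (c.out : solubleForms (IJ.1 : ℚ_[p]) (IJ.2 : ℚ_[p])).1 :=
  pgl2StabilizerCard_eq_of_mem_orbit ((mem_orbit_iff_pgl2Equiv _ _).mpr (rep_spec hint c))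

/-- `#Aut_{ℚ_p}(c) ≠ 0` for a soluble class `c` (it is `#E(ℚ_p)[2]`). [folklore] -/
theorem pgl2StabilizerCard_out_ne_zero (h4 : 4 * IJ.1 ^ 3 - IJ.2 ^ 2 ≠ 0)
    (c : Quotient (pgl2Setoid (IJ.1 : ℚ_[p]) (IJ.2 : ℚ_[p]))) :
    pgl2StabilizerCard (c.out : solubleForms (IJ.1 : ℚ_[p]) (IJ.2 : ℚ_[p])).1 ≠ 0 := by
  have h4' := four_mul_pow_sub_sq_cast_ne_zero p h4
  rw [pgl2StabilizerCard_eq_of_mem_solubleForms h4' (c.out : solubleForms (IJ.1 : ℚ_[p]) (IJ.2 : ℚ_[p])).2]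
  have hfin := finite_torsionBy_two (curveOfInvariants ℚ_[p] (IJ.1 : ℚ_[p]) (IJ.2 : ℚ_[p])) rfl rfl two_ne_zero
  haveI : Finite (AddSubgroup.torsionBy (curveOfInvariants ℚ_[p] (IJ.1 : ℚ_[p]) (IJ.2 : ℚ_[p])).toAffine.Point 2) :=
    hfin.to_subtype
  exact Nat.card_pos.ne'

/-- The orbits `B_p` of the integral representative form a finite set. [folklore] -/
theorem finite_intClassOrbits_rep (h4 : 4 * IJ.1 ^ 3 - IJ.2 ^ 2 ≠ 0)
    (hint : ∀ F : BinaryQuartic ℚ_[p], F.I = (IJ.1 : ℚ_[p]) → F.J = (IJ.2 : ℚ_[p]) → F.IsSoluble →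
      ∃ g : BinaryQuartic ℤ_[p], PGL2Equiv F (g.map ιp))
    (c : Quotient (pgl2Setoid (IJ.1 : ℚ_[p]) (IJ.2 : ℚ_[p]))) :
    (intClassOrbits ιp ((rep hint c).map ιp)).Finite :=
  finite_orbitsIn_of_finite (cosets_padic_finite _ (disc_rep_ne_zero h4 hint c))

/-- The orbits of class `c` are in bijection with `B_p(rep c)`. [folklore] -/
def classOrbitsEquiv
    (hint : ∀ F : BinaryQuartic ℚ_[p], F.I = (IJ.1 : ℚ_[p]) → F.J = (IJ.2 : ℚ_[p]) → F.IsSoluble →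
      ∃ g : BinaryQuartic ℤ_[p], PGL2Equiv F (g.map ιp))
    (c : Quotient (pgl2Setoid (IJ.1 : ℚ_[p]) (IJ.2 : ℚ_[p]))) :
    {q : solubleFibreOrbits IJ // cl q = c} ≃ intClassOrbits ιp ((rep hint c).map ιp) :=
  Equiv.ofBijective
    (fun q ↦ ⟨BinaryQuartic.map ιp '' orbitRel.Quotient.orbit (q.1 : orbitRel.Quotient G (BinaryQuartic ℤ_[p])), by
      have h := image_orbit_mem_intClassOrbits hint q.1
      rw [q.2] at h
      exact h⟩)
    ⟨fun q q' h ↦ Subtype.ext (Subtype.ext (eq_of_image_orbit_eq (congrArg Subtype.val h))),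
     fun O ↦ by
      obtain ⟨q, hq, hO⟩ := exists_eq_image_orbit hint O.2
      exact ⟨⟨q, hq⟩, Subtype.ext hO⟩⟩

/-- `(m · a)⁻¹` in `[0,∞]` is `ofReal (1/(m a))` for positive naturals. [folklore] -/
theorem inv_natCast_mul_inv_natCast {m a : ℕ} (hm : m ≠ 0) (ha : a ≠ 0) :
    ((m : ℝ≥0∞))⁻¹ * ((a : ℝ≥0∞))⁻¹ = ENNReal.ofReal ((1 : ℝ) / ((m : ℝ) * a)) := by
  have hm' : (0 : ℝ) < m := by exact_mod_cast Nat.pos_of_ne_zero hm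
  have ha' : (0 : ℝ) < a := by exact_mod_cast Nat.pos_of_ne_zero ha
  rw [one_div, mul_inv, ENNReal.ofReal_mul (inv_nonneg.mpr hm'.le), ENNReal.ofReal_inv_of_pos hm',
    ENNReal.ofReal_inv_of_pos ha', ENNReal.ofReal_natCast, ENNReal.ofReal_natCast]

/-- `m_p ≥ 1` on the integral representative's class: the weight of a point of an orbit of
`B_p(f)` is nonzero. [folklore] -/
theorem weight_ne_zero_of_mem {f : BinaryQuartic ℤ_[p]} (hΔ : f.disc ≠ 0) {O : Set (BinaryQuartic ℚ_[p])}
    (hO : O ∈ intClassOrbits ιp (f.map ιp)) {y : BinaryQuartic ℚ_[p]} (hy : y ∈ O) : weight ιp y ≠ 0 := by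
  have hfin := cosets_padic_finite f hΔ
  obtain ⟨g, hg⟩ := (mem_orbit_of_mem_intClassOrbits ιp hO hy).1
  rw [← hg, weight_smul]
  have hne : (intClassOrbits ιp (f.map ιp)).Nonempty := ⟨O, hO⟩
  have h1 : 1 ≤ (intClassOrbits ιp (f.map ιp)).ncard := (Set.ncard_pos (finite_orbitsIn_of_finite hfin)).mpr hne
  exact Nat.one_le_iff_ne_zero.mp (h1.trans (ncard_intClassOrbits_le_weight ιp _ hfin))

/-- `#Aut_{ℤ_p} ≠ 0` on the points of an orbit of `B_p(f)` with `#Aut_{ℚ_p}(f) ≠ 0`. [folklore] -/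
theorem autIntCard_ne_zero_of_mem {f : BinaryQuartic ℤ_[p]} (hS : pgl2StabilizerCard (f.map ιp) ≠ 0)
    {O : Set (BinaryQuartic ℚ_[p])} (hO : O ∈ intClassOrbits ιp (f.map ιp)) {y : BinaryQuartic ℚ_[p]} (hy : y ∈ O) :
    autIntCard ιp y ≠ 0 := by
  intro h0
  have hprod := autIndex_mul_autIntCard ιp y
  rw [h0, mul_zero, pgl2StabilizerCard_eq_of_mem_orbit (mem_orbit_of_mem_intClassOrbits ιp hO hy).1] at hprod
  exact hS hprod.symm

/-- **The orbits of one class**: `Σ_{𝒪 of class c} 1/(m_p(𝒪) #Aut_{ℤ_p}(𝒪)) = 1/#Aut_{ℚ_p}(c)`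
(Bhargava–Shankar, Cor. 3.8, through the dictionary of §1). [cite: BhargavaShankarAnnals2015, Cor. 3.8 (published numbering)] -/
theorem tsum_classFibre_eq (h4 : 4 * IJ.1 ^ 3 - IJ.2 ^ 2 ≠ 0)
    (hint : ∀ F : BinaryQuartic ℚ_[p], F.I = (IJ.1 : ℚ_[p]) → F.J = (IJ.2 : ℚ_[p]) → F.IsSoluble →
      ∃ g : BinaryQuartic ℤ_[p], PGL2Equiv F (g.map ιp))
    (c : Quotient (pgl2Setoid (IJ.1 : ℚ_[p]) (IJ.2 : ℚ_[p]))) :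
    ∑' q : {q : solubleFibreOrbits IJ // cl q = c},
        ((localWeight (Quotient.out (q.1 : orbitRel.Quotient G (BinaryQuartic ℤ_[p]))) : ℝ≥0∞))⁻¹ *
          ((autCard (Quotient.out (q.1 : orbitRel.Quotient G (BinaryQuartic ℤ_[p]))) : ℝ≥0∞))⁻¹ =
      ENNReal.ofReal ((1 : ℝ) / pgl2StabilizerCard (c.out : solubleForms (IJ.1 : ℚ_[p]) (IJ.2 : ℚ_[p])).1) := by
  set f₀ := rep hint c with hf₀
  have hΔ : f₀.disc ≠ 0 := disc_rep_ne_zero h4 hint c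
  have hS : pgl2StabilizerCard (f₀.map ιp) ≠ 0 := by
    rw [hf₀, pgl2StabilizerCard_rep hint c]; exact pgl2StabilizerCard_out_ne_zero h4 c
  set ICO := intClassOrbits ιp (f₀.map ιp) with hICO
  have hfin : ICO.Finite := finite_intClassOrbits_rep h4 hint c
  set e := classOrbitsEquiv hint c with he
  -- representatives of the orbits `O ∈ B_p(f₀)`
  set r : Set (BinaryQuartic ℚ_[p]) → BinaryQuartic ℚ_[p] := fun O ↦
    if h : O ∈ ICO then (Quotient.out ((e.symm ⟨O, h⟩).1 : orbitRel.Quotient G (BinaryQuartic ℤ_[p]))).map ιp else 0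
    with hr
  have hrO : ∀ O (h : O ∈ ICO), r O = (Quotient.out ((e.symm ⟨O, h⟩).1 : orbitRel.Quotient G (BinaryQuartic ℤ_[p]))).map ιp :=
    fun O h ↦ by rw [hr]; simp only [dif_pos h]
  have hrmem : ∀ O ∈ ICO, r O ∈ O := by
    intro O hO
    rw [hrO O hO]
    set x := e.symm ⟨O, hO⟩ with hx
    have hO' : BinaryQuartic.map ιp '' orbitRel.Quotient.orbit (x.1 : orbitRel.Quotient G (BinaryQuartic ℤ_[p])) = O := by
      have := congrArg Subtype.val (Equiv.apply_symm_apply e ⟨O, hO⟩)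
      rw [← hx] at this
      exact this
    have hmem : (Quotient.out (x.1 : orbitRel.Quotient G (BinaryQuartic ℤ_[p]))).map ιp ∈
        BinaryQuartic.map ιp '' orbitRel.Quotient.orbit (x.1 : orbitRel.Quotient G (BinaryQuartic ℤ_[p])) :=
      ⟨_, (orbitRel.Quotient.mem_orbit).mpr (Quotient.out_eq' _), rfl⟩
    rwa [hO'] at hmem
  -- the sum over the subtype as a sum over `B_p(f₀)`
  have hterm : ∀ q : {q : solubleFibreOrbits IJ // cl q = c},
      ((localWeight (Quotient.out (q.1 : orbitRel.Quotient G (BinaryQuartic ℤ_[p]))) : ℝ≥0∞))⁻¹ *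
          ((autCard (Quotient.out (q.1 : orbitRel.Quotient G (BinaryQuartic ℤ_[p]))) : ℝ≥0∞))⁻¹ =
        (fun O : ICO ↦ ENNReal.ofReal ((1 : ℝ) / ((weight ιp (r O) : ℝ) * autIntCard ιp (r O)))) (e q) := by
    intro q
    have hq : e.symm ⟨(e q : Set (BinaryQuartic ℚ_[p])), (e q).2⟩ = q := by simp
    simp only
    rw [hrO _ (e q).2, hq, ← autCard_eq_autIntCard]
    have hw : weight ιp ((Quotient.out (q.1 : orbitRel.Quotient G (BinaryQuartic ℤ_[p]))).map ιp) =
        localWeight (Quotient.out (q.1 : orbitRel.Quotient G (BinaryQuartic ℤ_[p]))) := rfl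
    rw [hw]
    refine inv_natCast_mul_inv_natCast ?_ ?_
    · rw [← hw, ← hq, ← hrO _ (e q).2]; exact weight_ne_zero_of_mem hΔ (e q).2 (hrmem _ (e q).2)
    · rw [autCard_eq_autIntCard, ← hq, ← hrO _ (e q).2]; exact autIntCard_ne_zero_of_mem hS (e q).2 (hrmem _ (e q).2)
  rw [tsum_congr hterm, Equiv.tsum_eq e (fun O : ICO ↦ ENNReal.ofReal ((1 : ℝ) / ((weight ιp (r O) : ℝ) * autIntCard ιp (r O))))]
  -- a finite sum of `ofReal`s
  haveI : Fintype ICO := hfin.fintype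
  rw [tsum_fintype, ← ENNReal.ofReal_sum_of_nonneg (fun O _ ↦ by positivity)]
  congr 1
  -- Bhargava–Shankar's Cor. 3.8 in `ℚ`, cast to `ℝ`
  have hmass := finsum_inv_localWeight_mul_autIntCard f₀ hΔ hS hrmem
  rw [finsum_mem_eq_finite_toFinset_sum _ hfin] at hmass
  have hcast := congrArg (fun x : ℚ ↦ (x : ℝ)) hmass
  simp only [Rat.cast_sum, Rat.cast_div, Rat.cast_one, Rat.cast_mul, Rat.cast_natCast] at hcast
  rw [hf₀, pgl2StabilizerCard_rep hint c,
    Finset.sum_subtype hfin.toFinset (fun O ↦ hfin.mem_toFinset)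
      (fun O ↦ (1 : ℝ) / ((weight ιp (r O) : ℝ) * autIntCard ιp (r O)))] at hcast
  exact hcast

/-- **The fibre identity** (Bhargava–Shankar, proof of Prop. 5.12: Cor. 3.8 + Lemmas 5.10–5.11).
For `(I, J) ∈ ℤ_p²` with `4I³ ≠ J²` such that every `ℚ_p`-soluble class with invariants `(I, J)`
meets `V_{ℤ_p}`:

  `Σ_{𝒪 ⊆ V_{ℤ_p} soluble over (I,J)} 1/(m_p(𝒪) #Aut_{ℤ_p}(𝒪)) = #(E_{I,J}(ℚ_p)/2E)/#E_{I,J}(ℚ_p)[2]`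

(`= localSelmerRatio p (I, J)`). [cite: BhargavaShankarAnnals2015, Prop. 5.12 proof (|2/27|_p Vol(PGL₂(ℤ_p)) ∫ Σ 1/#Aut; arXiv:1006.1002v2 numbering)] -/
theorem tsum_solubleFibreOrbits_eq (h4 : 4 * IJ.1 ^ 3 - IJ.2 ^ 2 ≠ 0)
    (hint : ∀ F : BinaryQuartic ℚ_[p], F.I = (IJ.1 : ℚ_[p]) → F.J = (IJ.2 : ℚ_[p]) → F.IsSoluble →
      ∃ g : BinaryQuartic ℤ_[p], PGL2Equiv F (g.map ιp)) :
    ∑' q : solubleFibreOrbits IJ,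
        ((localWeight (Quotient.out (q : orbitRel.Quotient G (BinaryQuartic ℤ_[p]))) : ℝ≥0∞))⁻¹ *
          ((autCard (Quotient.out (q : orbitRel.Quotient G (BinaryQuartic ℤ_[p]))) : ℝ≥0∞))⁻¹ =
      ENNReal.ofReal (localSelmerRatio p IJ) := by
  haveI := finite_solubleClasses_padic p h4
  haveI : Fintype (Quotient (pgl2Setoid (IJ.1 : ℚ_[p]) (IJ.2 : ℚ_[p]))) := Fintype.ofFinite _
  set t : solubleFibreOrbits IJ → ℝ≥0∞ := fun q ↦
    ((localWeight (Quotient.out (q : orbitRel.Quotient G (BinaryQuartic ℤ_[p]))) : ℝ≥0∞))⁻¹ *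
      ((autCard (Quotient.out (q : orbitRel.Quotient G (BinaryQuartic ℤ_[p]))) : ℝ≥0∞))⁻¹ with ht
  -- split the sum according to the class
  have hsplit : ∑' q, t q = ∑' c : Quotient (pgl2Setoid (IJ.1 : ℚ_[p]) (IJ.2 : ℚ_[p])),
      ∑' q : {q : solubleFibreOrbits IJ // cl q = c}, t q.1 := by
    rw [← Equiv.tsum_eq (Equiv.sigmaFiberEquiv (cl (IJ := IJ))) t, ENNReal.tsum_sigma']
    rfl
  change ∑' q, t q = _
  rw [hsplit]
  have hclass : ∀ c : Quotient (pgl2Setoid (IJ.1 : ℚ_[p]) (IJ.2 : ℚ_[p])),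
      ∑' q : {q : solubleFibreOrbits IJ // cl q = c}, t q.1 =
        ENNReal.ofReal ((1 : ℝ) / pgl2StabilizerCard (c.out : solubleForms (IJ.1 : ℚ_[p]) (IJ.2 : ℚ_[p])).1) :=
    fun c ↦ tsum_classFibre_eq h4 hint c
  rw [tsum_congr hclass, tsum_fintype, ← ENNReal.ofReal_sum_of_nonneg (fun c _ ↦ by positivity),
    ← finsum_inv_pgl2StabilizerCard_eq_localSelmerRatio p h4, finsum_eq_sum_of_fintype]

end FibreSum

end BinaryQuartic

end Literature.NumberTheory.EllipticCurves

end
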